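import Literature.MathematicalPhysics.KineticTheory.LambertianHardSphereFlow
import Literature.Probability.Entropy.StrongDataProcessingProofs
import HarnessLib

/-!
# The relative-entropy budget along the Lambertian hard-sphere flow

Helper file (`--supports`) for the crux `LambertianContactSwap.LambertianEuler`
(`AtomisticToContinuum/HydrodynamicLimit`, stmt-AtomisticToContinuum-11854), line `Sketch`,
registered sub-goal `klDiv_lambertFlow_le` of the stub `stub_ovyLambda` (the OVY/Yau
relative-entropy method for the Lambertian flow `Λ_t(z; ξs) = lambertFlow … ξs z t`, driven by
the i.i.d. Gaussian noise `ξs ~ lambertNoise = γ^ℕ`).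

**The entropy budget.** If a reference probability law `R` on the `(N + 1)`-sphere phase space is
`Λ_t`-invariant in law, `(R ⊗ γ^ℕ) ∘ Λ_t⁻¹ = R`, then for every initial law `P` the law
`(P ⊗ γ^ℕ) ∘ Λ_t⁻¹` of `Λ_t` started from `P` satisfies `H((P ⊗ γ^ℕ) ∘ Λ_t⁻¹ | R) ≤ H(P | R)`.
This is the data-processing inequality for the Markov kernel
`κ z := (δ_z ⊗ γ^ℕ) ∘ Λ_t⁻¹ = ((Kernel.id ×ₖ Kernel.const _ γ^ℕ).map Λ_t) z`:
`κ ∘ₘ P = (P ⊗ γ^ℕ) ∘ Λ_t⁻¹` (`map_prod_eq_map_comp`) and `κ ∘ₘ R = R` (the hypothesis), and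
`H(κ ∘ₘ P | κ ∘ₘ R) ≤ H(P | R)` is the tree's `Literature.Probability.Entropy.klDiv_comp_le`
(standard Borel source).  The abstract form is `klDiv_map_prod_le`; the registered statement is
its specialisation to `Config (N + 1) (Fin 3) 𝕋³` (standard Borel: a finite product of the Polish
spaces `𝕋³ × ℝ³`), `γ^ℕ = lambertNoise (Fin 3)` and `F = Λ_t`.
-/

noncomputable section

open scoped BigOperators Topology ENNReal InnerProductSpace
open MeasureTheory ProbabilityTheory Filter Set InformationTheory
open Literature.MathematicalPhysics.KineticTheory
open Literature.Analysis.FluidPDE Literature.Analysis.FluidPDE.Alexander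

namespace Summit.AtomisticToContinuum.HydrodynamicLimit.Theorems.LambertianContactSwapLambertianEulerEntropyBudget

/-! ## The abstract data-processing step -/

/-- **Push-forward of a product law as a kernel composition**: for s-finite `P`, `Q` and a
measurable `F : α × Ω → β`, `(P ⊗ Q) ∘ F⁻¹ = κ ∘ₘ P` with the kernel
`κ = (Kernel.id ×ₖ Kernel.const α Q).map F`, `κ a = (δ_a ⊗ Q) ∘ F⁻¹`. [folklore] -/
theorem map_prod_eq_map_comp {α Ω β : Type*} [MeasurableSpace α] [MeasurableSpace Ω]
    [MeasurableSpace β] (P : Measure α) [SFinite P] (Q : Measure Ω) [SFinite Q] {F : α × Ω → β}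
    (hF : Measurable F) :
    (P.prod Q).map F = ((Kernel.id ×ₖ Kernel.const α Q).map F) ∘ₘ P := by
  rw [← Measure.compProd_const, Measure.compProd_eq_comp_prod, Measure.map_comp _ _ hF]

/-- **Data processing through an independent randomisation**: for finite measures `P`, `R` on a
standard Borel space, a probability law `Q` of an independent noise and a measurable map
`F : α × Ω → β`, `H((P ⊗ Q) ∘ F⁻¹ | (R ⊗ Q) ∘ F⁻¹) ≤ H(P | R)` — the data-processing
inequality `klDiv_comp_le` for the Markov kernel `a ↦ (δ_a ⊗ Q) ∘ F⁻¹`. [folklore] -/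
theorem klDiv_map_prod_le {α Ω β : Type*} [MeasurableSpace α] [StandardBorelSpace α] [Nonempty α]
    [MeasurableSpace Ω] [MeasurableSpace β] (P R : Measure α) [IsFiniteMeasure P]
    [IsFiniteMeasure R] (Q : Measure Ω) [IsProbabilityMeasure Q] {F : α × Ω → β}
    (hF : Measurable F) :
    klDiv ((P.prod Q).map F) ((R.prod Q).map F) ≤ klDiv P R := by
  haveI : IsMarkovKernel ((Kernel.id ×ₖ Kernel.const α Q).map F) :=
    Kernel.IsMarkovKernel.map _ hF
  rw [map_prod_eq_map_comp P Q hF, map_prod_eq_map_comp R Q hF]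
  exact Literature.Probability.Entropy.klDiv_comp_le P R _

/-- **Entropy budget under an invariant reference law**: if moreover `(R ⊗ Q) ∘ F⁻¹ = R`, then
`H((P ⊗ Q) ∘ F⁻¹ | R) ≤ H(P | R)`. [folklore] -/
theorem klDiv_map_prod_le_of_invariant {α Ω : Type*} [MeasurableSpace α] [StandardBorelSpace α]
    [Nonempty α] [MeasurableSpace Ω] (P R : Measure α) [IsFiniteMeasure P] [IsFiniteMeasure R]
    (Q : Measure Ω) [IsProbabilityMeasure Q] {F : α × Ω → α} (hF : Measurable F)
    (hR : (R.prod Q).map F = R) :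
    klDiv ((P.prod Q).map F) R ≤ klDiv P R := by
  have h := klDiv_map_prod_le P R Q hF
  rwa [hR] at h

/-! ## The entropy budget along the Lambertian flow -/

/-- The `(N + 1)`-sphere phase space over `𝕋³`, `Config (N + 1) (Fin 3) 𝕋³ = (𝕋³ × ℝ³)^{N+1}`,
is a standard Borel space (a finite product of Polish spaces with their Borel σ-algebras).
[folklore] -/
theorem standardBorelSpace_config (n : ℕ) : StandardBorelSpace (Config n (Fin 3) T3) :=
  haveI : StandardBorelSpace (T3 × V3) := standardBorel_of_polish
  StandardBorelSpace.pi_countable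

/-- **The relative-entropy budget along the Lambertian flow** (registered sub-goal
`klDiv_lambertFlow_le` of `stub_ovyLambda`, line `Sketch`, crux stmt-AtomisticToContinuum-11854):
for every reduced diameter `σ`, every `N`, every time `t`, every initial probability law `P` and
every probability law `R` on the `(N + 1)`-sphere phase space which is invariant in law under the
Lambertian flow, `(R ⊗ γ^ℕ) ∘ Λ_t⁻¹ = R` (granted the joint measurability of `Λ_t` in
`(z, ξs)`), the law of `Λ_t` started from `P` satisfies
`H((P ⊗ γ^ℕ) ∘ Λ_t⁻¹ | R) ≤ H(P | R)` — the first line of the relative-entropy method, by the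
data-processing inequality for the kernel `z ↦ law of Λ_t(z; ·)`.
[cite: OllaVaradhanYau1993, §3] -/
theorem klDiv_lambertFlow_le :
    ∀ (σ : ℝ) (N : ℕ) (t : ℝ) (P R : Measure (Config (N + 1) (Fin 3) T3)) [IsProbabilityMeasure P]
      [IsProbabilityMeasure R],
    (Measurable fun p : Config (N + 1) (Fin 3) T3 × (ℕ → V3) =>
      lambertFlow (Torus.geometry (Fin 3)) (hsDiameter σ N) p.2 p.1 t) →
    ((R.prod (lambertNoise (Fin 3))).map
        (fun p => lambertFlow (Torus.geometry (Fin 3)) (hsDiameter σ N) p.2 p.1 t)) = R →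
    klDiv ((P.prod (lambertNoise (Fin 3))).map
        (fun p => lambertFlow (Torus.geometry (Fin 3)) (hsDiameter σ N) p.2 p.1 t)) R ≤ klDiv P R := by
  intro σ N t P R _ _ hΛ hR
  haveI : StandardBorelSpace (Config (N + 1) (Fin 3) T3) := standardBorelSpace_config (N + 1)
  exact klDiv_map_prod_le_of_invariant P R (lambertNoise (Fin 3)) hΛ hR

end Summit.AtomisticToContinuum.HydrodynamicLimit.Theorems.LambertianContactSwapLambertianEulerEntropyBudget

end
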